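import Summits.CriticalPhenomena.PercolationContinuityZ3.Theorems.PercNearOneGluingNoHeavyLowerTailSahiOneStepUniformThreshold
import Summits.CriticalPhenomena.PercolationContinuityZ3.Theorems.PercNearOneGluingNoHeavyLowerTailSahiOneStepFreeOddPrelim
import HarnessLib

/-!
# `(2′)` FOR EVERY HAMMING THRESHOLD WITH ONE FREE COORDINATE OF ARBITRARY DENSITY

Support file (prover prim-ineq-prove-3 gen 52; `--supports stmt-CriticalPhenomena-4575`; memo
`run/shared/lean/prim/prim-ineq-prove-3/PROOF-G52-FREE-ODD-COORDINATE.md`).  No definitions, no named facts, no sorries, no `native_decide`.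

**THEOREM (`osN_threshold_nonneg_of_const_free`).**  Let the density vector be a constant `P ∈ (0,1)` on the block `F` and ARBITRARY in `(0,1)` at one
further counted coordinate `o ∉ F`.  Then for every threshold `t` and all increasing `F`-determined events `A, B` (events not depending on `o`):
`0 ≤ n(Th_t(insert o F); A, B)`, i.e. `Cov(1_A,1_B) ≥ μ(N_{F ∪ {o}} < t)·Cov(1_A,1_B ∣ N_{F ∪ {o}} < t)`.
This is the first case of the `(2′)` half (INDEX §A of the memo series) for ALL pairs on a block with a NON-CONSTANT density vector; gen 21's
`osN_threshold_nonneg_of_const` is the case without `o`.  Equivalently (memo §1): on the UNIFORM cube `2^F`, collapsing the FUZZY Hamming ball with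
level profile `(1,…,1,θ,0,…)` (one partial boundary layer, weight `θ = 1 − p_o`) keeps increasing events positively correlated — a continuous
interpolation between the consecutive sharp thresholds `t−1` and `t` of gen 21.

Proof (memo §2–3): gen 21's induction on `F` verbatim (opposite compressions inside `F`, where the density is constant; `H`-generated hulls; the
cross-form step lemma `osN_ind_ind_nonneg_of_cross` at the pivot `e = ` the new coordinate), with two changes: the hull of an `o`-free event is
`o`-free (`determinedBy_hgen_of_free`), so `e` dominates `o` in the hull of `A` for free and MONO-A (`drift_nonneg_of_dominant`, any density) applies on
the block `insert o F`; and MONO-B is replaced by `drift_nonpos_of_dominated_free` (the sections of a dominated, generated, `o`-free `B` agree one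
level lower, which is exactly what ball monotonicity on `insert o F` needs).
-/

noncomputable section

namespace Summit.CriticalPhenomena.PercolationContinuityZ3.Theorems

namespace SahiOneStep

open MeasureTheory Finset
open Literature.Probability.Percolation (DeterminedBy determinedBy_iff)
open Literature.Probability.LatticeModels (prodBernoulli prodBernoulli_harris sahiE3)
open Literature.Probability.Percolation.DecisionTree (ind)
open SahiE3Sections (determinedBy_section_insert determinedBy_section_sdiff)
open scoped Classical

variable {ι : Type*} [Fintype ι]

/-- `n(H; ∅, B) = 0`. [this work] -/
theorem osN_ind_ind_empty_left (p : ι → unitInterval) (H B : Set (Set ι)) : osN p H (ind (∅ : Set (Set ι))) (ind B) = 0 := by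
  rw [osN_ind_ind, Set.inter_empty, Set.empty_inter, measureReal_empty]; ring

/-- **THE `(2′)` HALF FOR EVERY HAMMING THRESHOLD, CONSTANT DENSITY PLUS ONE FREE COORDINATE OF ARBITRARY DENSITY** (memo Theorem 1): density
`P ∈ (0,1)` on `F`, any density in `(0,1)` at `o ∉ F`, slot `Th_t(insert o F)`, all increasing `F`-determined `A, B`: `0 ≤ n(Th_t(insert o F); A, B)`.
[this work] -/
theorem osN_threshold_nonneg_of_const_free (p : ι → unitInterval) {P : ℝ} (hP0 : 0 < P) (hP1 : P < 1) {o : ι}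
    (hpo : 0 < (p o : ℝ) ∧ (p o : ℝ) < 1) (F : Finset ι) (hoF : o ∉ F)
    (hpF : ∀ i ∈ F, (p i : ℝ) = P) (t : ℕ) {A B : Set (Set ι)} (hA : IsUpperSet A) (hB : IsUpperSet B)
    (hAF : DeterminedBy A (↑F : Set ι)) (hBF : DeterminedBy B (↑F : Set ι)) :
    0 ≤ osN p {ω : Set ι | t ≤ ((insert o F).filter (· ∈ ω)).card} (ind A) (ind B) := by
  induction F using Finset.induction_on generalizing t A B with
  | empty =>
    -- an event determined by no coordinate is `∅` or everything (cf. `eq_empty_or_univ_of_determinedBy_empty` of `…SahiCombMasterFamily`)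
    have hagree : ∀ ω : Set ι, (∅ : Set ι) ∩ (↑(∅ : Finset ι) : Set ι) = ω ∩ ↑(∅ : Finset ι) := fun ω => by simp
    by_cases h : (∅ : Set ι) ∈ A
    · have hAu : A = Set.univ := Set.eq_univ_of_forall fun ω => ((determinedBy_iff _ _).1 hAF ∅ ω (hagree ω)).1 h
      rw [hAu]; exact (osN_ind_ind_univ_left p _ _).symm.le
    · have hAe : A = ∅ := Set.eq_empty_of_forall_notMem fun ω hω => h (((determinedBy_iff _ _).1 hAF ∅ ω (hagree ω)).2 hω)
      rw [hAe]; exact (osN_ind_ind_empty_left p _ _).symm.le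
  | insert e F heF ih =>
    have hoF' : o ∉ F := fun h => hoF (Finset.mem_insert_of_mem h)
    have heo : e ≠ o := fun h => hoF (Finset.mem_insert.2 (Or.inl h.symm))
    have hoEF : o ∉ insert e F := hoF
    have hpF' : ∀ i ∈ F, (p i : ℝ) = P := fun i hi => hpF i (Finset.mem_insert_of_mem hi)
    -- the slot block is `insert e G`, `G = insert o F`
    rw [Finset.insert_comm]
    set G : Finset ι := insert o F with hGdef
    have heG : e ∉ G := by
      intro h
      rcases Finset.mem_insert.1 h with h | h
      · exact heo h
      · exact heF h
    have hp01 : ∀ i ∈ G, 0 < (p i : ℝ) ∧ (p i : ℝ) < 1 := by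
      intro i hi
      rcases Finset.mem_insert.1 hi with rfl | hi
      · exact hpo
      · rw [hpF' i hi]; exact ⟨hP0, hP1⟩
    have hFG : (↑(insert e F) : Set ι) ⊆ ↑(insert e G) := by
      intro i hi
      simp only [Finset.coe_insert, Set.mem_insert_iff, Finset.mem_coe, hGdef] at hi ⊢
      tauto
    cases t with
    | zero => rw [threshold_zero, osN_ind_ind_univ]
    | succ t =>
      by_cases ht : t ≤ G.card
      swap
      · rw [threshold_eq_empty_of_card_lt (insert e G) (by rw [Finset.card_insert_of_notMem heG]; omega), osN_ind_ind_empty]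
      rcases Nat.eq_zero_or_pos t with rfl | htpos
      · exact osN_thresholdOne_nonneg p (insert e G) hA hB (hAF.mono hFG) (hBF.mono hFG)
      -- `1 ≤ t ≤ #G`: inner induction on the potential
      have heG' : e ∈ insert e G := Finset.mem_insert_self e G
      have heEF : e ∈ insert e F := Finset.mem_insert_self e F
      have hHup : IsUpperSet {ω : Set ι | t + 1 ≤ ((insert e G).filter (· ∈ ω)).card} := isUpperSet_threshold _ _
      have hcoe : (↑(insert e F) : Set ι) \ {e} = ↑F := by
        ext i
        simp only [Set.mem_sdiff, Finset.coe_insert, Set.mem_insert_iff, Finset.mem_coe, Set.mem_singleton_iff]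
        constructor
        · rintro ⟨h | h, hne⟩
          · exact absurd h hne
          · exact h
        · intro h
          exact ⟨Or.inr h, fun hie => heF (hie ▸ h)⟩
      suffices key : ∀ (m : ℕ) (A B : Set (Set ι)), IsUpperSet A → IsUpperSet B →
          DeterminedBy A (↑(insert e F) : Set ι) → DeterminedBy B (↑(insert e F) : Set ι) →
          #((insert e F).powerset.filter fun S : Finset ι => (((↑S : Set ι) ∈ A) ∧ e ∉ S)) +
            #((insert e F).powerset.filter fun S : Finset ι => (((↑S : Set ι) ∈ B) ∧ e ∈ S)) = m →
          0 ≤ osN p {ω : Set ι | t + 1 ≤ ((insert e G).filter (· ∈ ω)).card} (ind A) (ind B) from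
        key _ A B hA hB hAF hBF rfl
      intro m
      induction m using Nat.strong_induction_on with
      | _ m ihm =>
      intro A B hA hB hAF hBF hm
      by_cases hdom : (∀ j ∈ F, ∀ ω ∈ A, e ∉ ω → j ∈ ω → (ω \ {j}) ∪ {e} ∈ A) ∧
          (∀ j ∈ F, ∀ ω ∈ B, e ∈ ω → j ∉ ω → (ω \ {e}) ∪ {j} ∈ B)
      · -- dominated pair: pass to the `H`-generated hulls (still `o`-free) and apply the cross-form step lemma
        obtain ⟨hdomA, hdomB⟩ := hdom
        have hA'up := isUpperSet_hgen {ω : Set ι | t + 1 ≤ ((insert e G).filter (· ∈ ω)).card} A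
        have hB'up := isUpperSet_hgen {ω : Set ι | t + 1 ≤ ((insert e G).filter (· ∈ ω)).card} B
        have hA'G : DeterminedBy {ω : Set ι | ∀ ω' : Set ι, ω ⊆ ω' → ω' ∈ {ω : Set ι | t + 1 ≤ ((insert e G).filter (· ∈ ω)).card} → ω' ∈ A}
            (↑(insert e F) : Set ι) := determinedBy_hgen_of_free hoEF (t + 1) hAF
        have hB'G : DeterminedBy {ω : Set ι | ∀ ω' : Set ι, ω ⊆ ω' → ω' ∈ {ω : Set ι | t + 1 ≤ ((insert e G).filter (· ∈ ω)).card} → ω' ∈ B}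
            (↑(insert e F) : Set ι) := determinedBy_hgen_of_free hoEF (t + 1) hBF
        refine le_trans ?_ (osN_ind_ind_hgen_le p hHup hA hB)
        refine le_trans ?_ (osN_ind_ind_hgen_le_right p hHup hA'up hB)
        refine osN_ind_ind_nonneg_of_cross p _ _ _ e ?_ ?_ ?_ ?_ ?_ ?_ ?_ ?_
        · rw [section_insert_threshold heG]
          exact ih hoF' hpF' t (isUpperSet_section_insert hA'up e) (isUpperSet_section_insert hB'up e)
            (hcoe ▸ determinedBy_section_insert hA'G e) (hcoe ▸ determinedBy_section_insert hB'G e)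
        · rw [section_sdiff_threshold heG]
          exact ih hoF' hpF' (t + 1) (isUpperSet_section_sdiff hA'up e) (isUpperSet_section_sdiff hB'up e)
            (hcoe ▸ determinedBy_section_sdiff hA'G e) (hcoe ▸ determinedBy_section_sdiff hB'G e)
        · rw [section_insert_threshold heG]; exact real_threshold_lt_one p G hp01 t htpos
        · rw [section_sdiff_threshold heG]; exact real_threshold_lt_one p G hp01 (t + 1) (by omega)
        · exact measureReal_mono (section_sdiff_subset_section_insert hA'up e)
        · exact measureReal_mono (section_sdiff_subset_section_insert hB'up e)
        · refine drift_nonneg_of_dominant p heG ht hp01 hA'up (hA'G.mono hFG) ?_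
          intro ω hω heω j hj hjω
          rcases Finset.mem_insert.1 hj with rfl | hjF
          · -- `j = o`: the hull is `o`-free, so `e` dominates `o` for free
            have hfree : ω \ {j} ∈ {ω : Set ι | ∀ ω' : Set ι, ω ⊆ ω' →
                ω' ∈ {ω : Set ι | t + 1 ≤ ((insert e G).filter (· ∈ ω)).card} → ω' ∈ A} := by
              refine mem_of_union_mem_of_determinedBy hA'G (by exact_mod_cast hoEF) ?_
              have hωeq : ω \ {j} ∪ {j} = ω := by
                rw [Set.sdiff_union_self, Set.union_eq_left.2 (Set.singleton_subset_iff.2 hjω)]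
              rw [hωeq]; exact hω
            exact hA'up Set.subset_union_left hfree
          · exact dominant_hgen heG' (Finset.mem_insert_of_mem (Finset.mem_insert_of_mem hjF)) (fun h => heF (h ▸ hjF)) (t + 1)
              (hdomA j hjF) ω hω heω hjω
        · exact drift_nonpos_of_dominated_free p heo heF hoF' t hB'up hB'G
            (fun ω hω heω j hj hjω => dominated_hgen heG' (Finset.mem_insert_of_mem (Finset.mem_insert_of_mem hj))
              (fun h => heF (h ▸ hj)) (t + 1) (hdomB j hj) ω hω heω hjω)
            (fun ω h ω' hsub hH' => h ω' hsub hH' ω' subset_rfl hH')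
      · -- a trade fails: compress along that pair of coordinates; the potential drops
        have hex : ∃ j ∈ F, (∃ ω ∈ A, e ∉ ω ∧ j ∈ ω ∧ (ω \ {j}) ∪ {e} ∉ A) ∨ (∃ ω ∈ B, e ∈ ω ∧ j ∉ ω ∧ (ω \ {e}) ∪ {j} ∉ B) := by
          rw [not_and_or] at hdom
          rcases hdom with h | h
          · push Not at h
            obtain ⟨j, hj, ω, hω, heω, hjω, hno⟩ := h
            exact ⟨j, hj, Or.inl ⟨ω, hω, heω, hjω, hno⟩⟩
          · push Not at h
            obtain ⟨j, hj, ω, hω, heω, hjω, hno⟩ := h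
            exact ⟨j, hj, Or.inr ⟨ω, hω, heω, hjω, hno⟩⟩
        obtain ⟨j, hjF, hwit⟩ := hex
        have hej : e ≠ j := fun h => heF (h ▸ hjF)
        have hjG : j ∈ insert e F := Finset.mem_insert_of_mem hjF
        have hpej : p e = p j := Subtype.ext (by rw [hpF e heEF, hpF j hjG])
        -- the compressions of `A` towards `e` and of `B` towards `j`
        -- (introduced as opaque sets, characterised by their membership)
        obtain ⟨CA, hCAdef⟩ : ∃ CA : Set (Set ι), CA = {ω : Set ι | (ω ∈ A ∧ {x : ι | Equiv.swap e j x ∈ ω} ∈ A) ∨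
          (e ∈ ω ∧ j ∉ ω ∧ (ω ∈ A ∨ {x : ι | Equiv.swap e j x ∈ ω} ∈ A))} := ⟨_, rfl⟩
        obtain ⟨CB, hCBdef⟩ : ∃ CB : Set (Set ι), CB = {ω : Set ι | (ω ∈ B ∧ {x : ι | Equiv.swap e j x ∈ ω} ∈ B) ∨
          (j ∈ ω ∧ e ∉ ω ∧ (ω ∈ B ∨ {x : ι | Equiv.swap e j x ∈ ω} ∈ B))} := ⟨_, rfl⟩
        have hCA : ∀ ω : Set ι, ω ∈ CA ↔ (ω ∈ A ∧ {x : ι | Equiv.swap e j x ∈ ω} ∈ A) ∨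
            (e ∈ ω ∧ j ∉ ω ∧ (ω ∈ A ∨ {x : ι | Equiv.swap e j x ∈ ω} ∈ A)) := fun ω => by rw [hCAdef]; exact Iff.rfl
        have hCB : ∀ ω : Set ι, ω ∈ CB ↔ (ω ∈ B ∧ {x : ι | Equiv.swap e j x ∈ ω} ∈ B) ∨
            (j ∈ ω ∧ e ∉ ω ∧ (ω ∈ B ∨ {x : ι | Equiv.swap e j x ∈ ω} ∈ B)) := fun ω => by rw [hCBdef]; exact Iff.rfl
        have hCB' : ∀ ω : Set ι, ω ∈ CB ↔ (ω ∈ B ∧ {x : ι | Equiv.swap j e x ∈ ω} ∈ B) ∨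
            (j ∈ ω ∧ e ∉ ω ∧ (ω ∈ B ∨ {x : ι | Equiv.swap j e x ∈ ω} ∈ B)) := by
          intro ω; rw [Equiv.swap_comm j e]; exact hCB ω
        have hCAup : IsUpperSet CA := isUpperSet_of_compress hej hA hCA
        have hCBup : IsUpperSet CB := isUpperSet_of_compress hej.symm hB hCB'
        have hCAG : DeterminedBy CA (↑(insert e F) : Set ι) := determinedBy_of_compress heEF hjG hAF hCA
        have hCBG : DeterminedBy CB (↑(insert e F) : Set ι) := determinedBy_of_compress hjG heEF hBF hCB'
        -- the potential drops
        have hsubA := filter_pat_compress_subset (G := insert e F) hCA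
        have hsubB := filter_pat_compress_subset' (G := insert e F) hCB
        have hlt : #((insert e F).powerset.filter fun S : Finset ι => (((↑S : Set ι) ∈ CA) ∧ e ∉ S)) +
            #((insert e F).powerset.filter fun S : Finset ι => (((↑S : Set ι) ∈ CB) ∧ e ∈ S)) < m := by
          rcases hwit with ⟨ω, hωA, heω, hjω, hno⟩ | ⟨ω, hωB, heω, hjω, hno⟩
          · have hS₀e : e ∉ ((↑((insert e F).filter (· ∈ ω)) : Set ι)) := fun h => by
              rw [Finset.mem_coe, Finset.mem_filter] at h; exact heω h.2
            have hS₀j : j ∈ ((↑((insert e F).filter (· ∈ ω)) : Set ι)) := by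
              rw [Finset.mem_coe, Finset.mem_filter]; exact ⟨hjG, hjω⟩
            have hS₀A : (insert e F).filter (· ∈ ω) ∈ (insert e F).powerset.filter (fun S : Finset ι => (((↑S : Set ι) ∈ A) ∧ e ∉ S)) := by
              rw [Finset.mem_filter]
              exact ⟨Finset.mem_powerset.2 (Finset.filter_subset _ _), (coe_filter_mem_iff hAF ω).2 hωA,
                fun h => heω (Finset.mem_filter.1 h).2⟩
            have hS₀C : (insert e F).filter (· ∈ ω) ∉ (insert e F).powerset.filter (fun S : Finset ι => (((↑S : Set ι) ∈ CA) ∧ e ∉ S)) := by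
              intro h
              rw [Finset.mem_filter] at h
              rcases (hCA _).1 h.2.1 with ⟨_, hσ⟩ | ⟨he', _, _⟩
              · rw [swapSet_eq_trade hS₀e hS₀j] at hσ
                have htr := trade_inter_eq (coe_filter_inter_eq (insert e F) ω) j e
                exact hno (((determinedBy_iff _ _).1 hAF _ _ htr).1 hσ)
              · exact hS₀e he'
            have h1 := Finset.card_lt_card ((Finset.ssubset_iff_of_subset hsubA).2 ⟨_, hS₀A, hS₀C⟩)
            have h2 := Finset.card_le_card hsubB
            omega
          · have hS₀e : e ∈ ((↑((insert e F).filter (· ∈ ω)) : Set ι)) := by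
              rw [Finset.mem_coe, Finset.mem_filter]; exact ⟨heEF, heω⟩
            have hS₀j : j ∉ ((↑((insert e F).filter (· ∈ ω)) : Set ι)) := fun h => by
              rw [Finset.mem_coe, Finset.mem_filter] at h; exact hjω h.2
            have hS₀B : (insert e F).filter (· ∈ ω) ∈ (insert e F).powerset.filter (fun S : Finset ι => (((↑S : Set ι) ∈ B) ∧ e ∈ S)) := by
              rw [Finset.mem_filter]
              exact ⟨Finset.mem_powerset.2 (Finset.filter_subset _ _), (coe_filter_mem_iff hBF ω).2 hωB,
                Finset.mem_filter.2 ⟨heEF, heω⟩⟩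
            have hS₀C : (insert e F).filter (· ∈ ω) ∉ (insert e F).powerset.filter (fun S : Finset ι => (((↑S : Set ι) ∈ CB) ∧ e ∈ S)) := by
              intro h
              rw [Finset.mem_filter] at h
              rcases (hCB _).1 h.2.1 with ⟨_, hσ⟩ | ⟨_, he', _⟩
              · rw [swapSet_eq_trade' hS₀e hS₀j] at hσ
                have htr := trade_inter_eq (coe_filter_inter_eq (insert e F) ω) e j
                exact hno (((determinedBy_iff _ _).1 hBF _ _ htr).1 hσ)
              · exact he' hS₀e
            have h1 := Finset.card_le_card hsubA
            have h2 := Finset.card_lt_card ((Finset.ssubset_iff_of_subset hsubB).2 ⟨_, hS₀B, hS₀C⟩)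
            omega
        calc (0 : ℝ) ≤ osN p {ω : Set ι | t + 1 ≤ ((insert e G).filter (· ∈ ω)).card} (ind CA) (ind CB) :=
              ihm _ hlt CA CB hCAup hCBup hCAG hCBG rfl
          _ ≤ osN p {ω : Set ι | t + 1 ≤ ((insert e G).filter (· ∈ ω)).card} (ind A) (ind B) :=
              osN_compress_le p heG' (Finset.mem_insert_of_mem (Finset.mem_insert_of_mem hjF)) hpej (t + 1)
                (hAF.mono hFG) (hBF.mono hFG) hCA hCB


end SahiOneStep

end Summit.CriticalPhenomena.PercolationContinuityZ3.Theorems
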